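import Literature.RingTheory.Etale.WeaklyEtaleGermRing
import Literature.RingTheory.Etale.EtaleClosedCover
import Literature.RingTheory.Localization.ConstructibleLocalization

/-!
# Bhatt–Scholze, Theorem 2.3.4: weakly étale algebras receive faithfully flat maps from
# ind-étale algebras

[cite: BhattScholze2015 = arXiv:1309.1198v2, Theorem 2.3.4; StacksProject, Tag 097Z]

**Theorem** (`exists_indEtale_faithfullyFlat_of_weaklyEtale`).  Let `A → B` be weakly étale.
There is an ind-étale `A`-algebra `C♮` (in the sense `FactorsEtale A C♮`) and a faithfully flat
`A`-algebra map `B → C♮`.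

Assembly of the pieces: `A₁ = CLoc A` (the constructible localization: ind-Zariski, all primes
above `CLoc.ideal A` maximal and jointly surjecting onto `Spec A`), `C` the étale tower of `A₁`
(`ETower`: ind-étale, faithfully flat, every faithfully flat étale `C`-algebra has a retraction),
`J = (CLoc.ideal A) C`; then `WeaklyEtaleGermRing.exists_factorsEtale_faithfullyFlat` applies:
primes of `C` above `J` are maximal (zero-dimensional fibres of `A₁ → C`), and every maximal
ideal of `B` lies under a point of `X♮` (primes of `C ⊗[A] B` above a pair of primes with the
same restriction to `A`).
-/

universe u

namespace Literature.RingTheory.Etale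

open TensorProduct Literature.RingTheory.Localization

noncomputable section

/-- **The globalization over the constructible localization.**  Let `A → B` be weakly étale
and let `C` be a faithfully flat ind-étale `CLoc A`-algebra in which every faithfully flat étale
cover splits.  Then the germ ring of `B` over `C` (with `J = (CLoc.ideal A) C`) is an ind-étale
`A`-algebra receiving a faithfully flat map from `B`. [cite: BhattScholze2015, Theorem 2.3.4;
StacksProject, Tag 097Z] -/
theorem exists_indEtale_faithfullyFlat_over (A B C : Type u) [CommRing A] [CommRing B]
    [Algebra A B] [Algebra.WeaklyEtale A B] [CommRing C] [Algebra (CLoc A) C] [Algebra A C]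
    [IsScalarTower A (CLoc A) C] [Module.FaithfullyFlat (CLoc A) C] (hC₁ : FactorsEtale (CLoc A) C)
    (hret : ∀ (Y : Type u) [CommRing Y] [Algebra C Y] [Algebra.Etale C Y]
      [Module.FaithfullyFlat C Y], Nonempty (Y →ₐ[C] C)) :
    ∃ (G : Type u) (_ : CommRing G) (_ : Algebra A G) (Φ : B →ₐ[A] G),
      FactorsEtale A G ∧ Φ.toRingHom.FaithfullyFlat := by
  classical
  have hC : FactorsEtale A C := (CLoc.factorsEtale A).trans hC₁
  haveI : Algebra.WeaklyEtale (CLoc A) C := hC₁.weaklyEtale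
  -- the ideal of closed points
  set J : Ideal C := (CLoc.ideal A).map (algebraMap (CLoc A) C) with hJdef
  have hJ : ∀ Q : Ideal C, Q.IsPrime → J ≤ Q → Q.IsMaximal := by
    intro Q hQ hJQ
    have hle : CLoc.ideal A ≤ Q.under (CLoc A) := Ideal.map_le_iff_le_comap.1 hJQ
    exact isMaximal_of_weaklyEtale_of_isMaximal_under (A := CLoc A) Q
      (CLoc.isMaximal_of_ideal_le (Q.under (CLoc A)) hle)
  -- every maximal ideal of `B` lies under a point above `J`
  have hsurj : ∀ 𝔫 : Ideal B, 𝔫.IsMaximal →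
      ∃ x : GermRing.Pt A B J, ∀ b ∈ 𝔫, (1 : C) ⊗ₜ[A] b ∈ x.1.asIdeal := by
    intro 𝔫 h𝔫
    haveI := h𝔫.isPrime
    obtain ⟨P, hP, hle, hP𝔭⟩ := CLoc.exists_prime_over (𝔫.under A)
    haveI := hP
    obtain ⟨⟨m', hm'⟩, hm'P⟩ :=
      PrimeSpectrum.comap_surjective_of_faithfullyFlat (A := CLoc A) (B := C) ⟨P, hP⟩
    have hm'P' : m'.comap (algebraMap (CLoc A) C) = P := congrArg PrimeSpectrum.asIdeal hm'P
    haveI : m'.IsPrime := hm'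
    have hcomapA : m'.comap (algebraMap A C) = 𝔫.comap (algebraMap A B) := by
      rw [IsScalarTower.algebraMap_eq A (CLoc A) C, ← Ideal.comap_comap, hm'P', hP𝔭]
    obtain ⟨X0, hX0, hXl, hXr⟩ := exists_isPrime_tensorProduct_comap_eq (A := A) m' 𝔫 hcomapA
    have hJX : J.map (algebraMap C (C ⊗[A] B)) ≤ X0 := by
      rw [Ideal.map_le_iff_le_comap]
      have : X0.comap (algebraMap C (C ⊗[A] B)) = m' := hXl
      rw [this, hJdef, Ideal.map_le_iff_le_comap, hm'P']
      exact hle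
    refine ⟨⟨⟨X0, hX0⟩, hJX⟩, fun b hb => ?_⟩
    have : b ∈ X0.comap ((Algebra.TensorProduct.includeRight : B →ₐ[A] C ⊗[A] B) :
        B →+* C ⊗[A] B) := by rw [hXr]; exact hb
    exact this
  exact GermRing.exists_factorsEtale_faithfullyFlat hret hJ hC hsurj

/-- The `A`-algebra structure on the étale tower over the constructible localization
(a `def`, activated locally). [folklore] -/
@[reducible] def bsCoverAlgebra (A : Type u) [CommRing A] : Algebra A (ETower (CLoc A)) :=
  ((algebraMap (CLoc A) (ETower (CLoc A))).comp (algebraMap A (CLoc A))).toAlgebra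

/-- **Bhatt–Scholze, Theorem 2.3.4** (in the form used for the comparison of étale and
pro-étale cohomology): for `A → B` weakly étale there exist an ind-étale `A`-algebra `C♮` and a
faithfully flat `A`-algebra map `B → C♮`.  Take `C = ETower (CLoc A)`, the étale tower
(`EtaleClosedCover`) over the constructible localization (`ConstructibleLocalization`).
[cite: BhattScholze2015, Theorem 2.3.4; StacksProject, Tag 097Z] -/
theorem exists_indEtale_faithfullyFlat_of_weaklyEtale (A B : Type u) [CommRing A] [CommRing B]
    [Algebra A B] [Algebra.WeaklyEtale A B] :
    ∃ (G : Type u) (_ : CommRing G) (_ : Algebra A G) (Φ : B →ₐ[A] G),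
      FactorsEtale A G ∧ Φ.toRingHom.FaithfullyFlat := by
  letI : Algebra A (ETower (CLoc A)) := bsCoverAlgebra A
  haveI : IsScalarTower A (CLoc A) (ETower (CLoc A)) := IsScalarTower.of_algebraMap_eq fun _ => rfl
  exact exists_indEtale_faithfullyFlat_over A B (ETower (CLoc A)) (ETower.factorsEtale (CLoc A))
    (fun Y _ _ _ _ => ETower.retraction (X := CLoc A) Y)

end

end Literature.RingTheory.Etale
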